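import Summits.Ventures.PercRepro.C041ZonePortCaseIVB

/-!
# The zone port problem of THEOREM R: the sub-problem beyond a unique gate zone (p6, gen 24)

Setting of `C041ZonePortDefs` (mine-3, C-041.md §3 (v) / §6 (c)).  When the port-free reach `R₀` of the root set has
a UNIQUE gate zone `C`, every path from the root set to a port vertex leaves `R₀` into `C` and never needs `R₀`
again; the SUB-PROBLEM `P.sub C hC` is the same graph with the vertices of `R₀` deleted (`adj a b ∧ a ∉ R₀ ∧ b ∉ R₀`),
ROOTED AT THE ZONE `C` (a root set — this is why the general problem carries one), with the zones `Z.erase C` and the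
same terminal edges.  The dictionary between the two problems:

* `exists_gate_of_reach` — a path from the root set to a vertex outside `R₀` avoiding `A` passes a gate vertex `g ∉ A`
  and from `g` on stays outside `R₀`; with a unique gate `C` it is a path of the sub-problem from `g ∈ C`
  (`reach_sub_of_reach`);
* `reach_of_reach_sub` — a path of the sub-problem from a vertex of `C` is a path of `P` from the root set (prepended
  by THE KEY FACT's path to that vertex, `C` not deleted);
* `reach_iff_reach_sub` — for `A ⊆ PV` disjoint from `C` and a target outside `R₀`: `RReach_P A q ↔ RReach_{sub} A q`;
* `not_reach_of_gate_mem` — with `C ⊆ A` no vertex outside `R₀` is reached from the root set avoiding `A`;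
* `sub_zonesReached` — every zone of the sub-problem is reached from its root set `C`.
-/

namespace PercRepro

namespace ZonePort

namespace Problem

open Finset

variable {V E : Type*}

/-- The sub-problem beyond the gate zone `C`: the graph with `R₀` deleted, root set `C`, zones `Z.erase C`. -/
def sub [DecidableEq V] (P : Problem V E) (C : Finset V) (hC : C ∈ P.Z) : Problem V E where
  adj a b := P.adj a b ∧ a ∉ P.R₀ ∧ b ∉ P.R₀
  symm _ _ h := ⟨P.symm _ _ h.1, h.2.2, h.2.1⟩
  root := C
  Z := P.Z.erase C
  hdisj D hD D' hD' hne := P.hdisj D (Finset.mem_of_mem_erase hD) D' (Finset.mem_of_mem_erase hD') hne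
  hroot D hD v hv := P.hdisj D (Finset.mem_of_mem_erase hD) C hC (Finset.mem_erase.1 hD).1 v hv
  hzconn D hD u hu w hw := by
    have hDZ : D ∈ P.Z := Finset.mem_of_mem_erase hD
    refine reflTransGen_mono (fun a b hab => ⟨⟨hab.1, not_mem_R₀_of_mem_zone hDZ hab.2.1,
      not_mem_R₀_of_mem_zone hDZ hab.2.2⟩, hab.2.1, hab.2.2⟩) (P.hzconn D hDZ u hu w hw)
  tv := P.tv
  ts := P.ts
  tz := P.tz
  htv := P.htv
  sw := P.sw
  hk D hD := P.hk D (Finset.mem_of_mem_erase hD)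

variable {P : Problem V E}

/-- **Leaving `R₀`**: a path from the root set avoiding `A` that ends outside `R₀` passes a vertex `g ∉ A` of a gate
zone, and from `g` on it avoids `R₀`. -/
theorem exists_gate_of_reach {A : Set V} {q : V} (h : P.RReach A q) (hq : q ∉ P.R₀) :
    ∃ D, P.IsGate D ∧ ∃ g ∈ D, g ∉ A ∧
      Relation.ReflTransGen (fun a b => (P.adj a b ∧ a ∉ P.R₀ ∧ b ∉ P.R₀) ∧ b ∉ A) g q := by
  obtain ⟨u, hu, _, hw⟩ := h
  -- invariant: either still inside `R₀`, or a gate vertex has been passed and the path stays outside `R₀`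
  have key : ∀ v, Relation.ReflTransGen (fun a b => P.adj a b ∧ b ∉ A) u v →
      v ∈ P.R₀ ∨ ∃ D, P.IsGate D ∧ ∃ g ∈ D, g ∉ A ∧
        Relation.ReflTransGen (fun a b => (P.adj a b ∧ a ∉ P.R₀ ∧ b ∉ P.R₀) ∧ b ∉ A) g v := by
    intro v hv
    induction hv with
    | refl => exact Or.inl (root_subset_R₀ hu)
    | @tail b d _ hbd ih =>
      rcases ih with hb | ⟨D, hD, g, hg, hgA, hw'⟩
      · by_cases hd : d ∈ P.PV
        · -- `d` lies in a gate zone, reached from `b ∈ R₀`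
          obtain ⟨D, hDZ, hdD⟩ := hd
          exact Or.inr ⟨D, ⟨hDZ, b, hb, d, hdD, hbd.1⟩, d, hdD, hbd.2, Relation.ReflTransGen.refl⟩
        · obtain ⟨u', hu', hb'⟩ := hb
          exact Or.inl ⟨u', hu', hb'.1, hb'.2.tail ⟨hbd.1, hd⟩⟩
      · by_cases hdR : d ∈ P.R₀
        · -- back into `R₀`: the path so far is forgotten, we are inside again
          exact Or.inl hdR
        · have hbR : b ∉ P.R₀ := by
            rcases Relation.ReflTransGen.cases_tail hw' with h | ⟨_, _, hlast⟩
            · exact h ▸ not_mem_R₀_of_mem_zone hD.mem hg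
            · exact hlast.1.2.2
          exact Or.inr ⟨D, hD, g, hg, hgA, hw'.tail ⟨⟨hbd.1, hbR, hdR⟩, hbd.2⟩⟩
  rcases key q hw with h | h
  · exact absurd h hq
  · exact h

variable [DecidableEq V]

/-- With a unique gate zone `C`, a path from the root set avoiding `A` to a vertex outside `R₀` is, from its first
vertex of `C` on, a path of the sub-problem. -/
theorem reach_sub_of_reach {C : Finset V} (hC : C ∈ P.Z) (huniq : ∀ D, P.IsGate D → D = C)
    {A : Set V} {q : V} (h : P.RReach A q) (hq : q ∉ P.R₀) : (P.sub C hC).RReach A q := by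
  obtain ⟨D, hD, g, hg, hgA, hw⟩ := exists_gate_of_reach h hq
  have hDC : D = C := huniq D hD
  subst hDC
  exact ⟨g, hg, hgA, hw⟩

/-- A path of the sub-problem from the gate zone `C` is a path of `P` from the root set (prepend THE KEY FACT's
path). -/
theorem reach_of_reach_sub {C : Finset V} (hC : P.IsGate C) {A : Set V} (hA : A ⊆ P.PV)
    (hCA : ∀ v ∈ C, v ∉ A) {q : V} (h : (P.sub C hC.mem).RReach A q) : P.RReach A q := by
  obtain ⟨g, hg, h⟩ := h
  refine (reach_gate hA hC hCA hg).trans ⟨h.1, ?_⟩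
  exact reflTransGen_mono (fun _ _ hab => ⟨hab.1.1, hab.2⟩) h.2

/-- **The reachability dictionary** across a unique gate zone `C` disjoint from `A`: for `q ∉ R₀`,
`RReach_P A q ↔ RReach_{sub} A q`. -/
theorem reach_iff_reach_sub {C : Finset V} (hC : P.IsGate C) (huniq : ∀ D, P.IsGate D → D = C)
    {A : Set V} (hA : A ⊆ P.PV) (hCA : ∀ v ∈ C, v ∉ A) {q : V} (hq : q ∉ P.R₀) :
    P.RReach A q ↔ (P.sub C hC.mem).RReach A q :=
  ⟨fun h => reach_sub_of_reach hC.mem huniq h hq, fun h => reach_of_reach_sub hC hA hCA h⟩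

omit [DecidableEq V] in
/-- With the unique gate zone deleted (`C ⊆ A`), no vertex outside `R₀` is reached from the root set avoiding `A`. -/
theorem not_reach_of_gate_mem {C : Finset V} (huniq : ∀ D, P.IsGate D → D = C) {A : Set V}
    (hCA : ∀ v ∈ C, v ∈ A) {q : V} (hq : q ∉ P.R₀) : ¬ P.RReach A q := by
  intro h
  obtain ⟨D, hD, g, hg, hgA, _⟩ := exists_gate_of_reach h hq
  exact hgA (hCA g (huniq D hD ▸ hg))

/-- **The sub-problem is connected from its root zone**: every zone of `P.sub C hC` is reached from `C` — the zones
of `P` other than `C` lie outside `R₀`. -/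
theorem sub_zonesReached {C : Finset V} (hC : P.IsGate C) (huniq : ∀ D, P.IsGate D → D = C)
    (hconn : P.ZonesReached) : (P.sub C hC.mem).ZonesReached := by
  intro D hD
  have hDZ : D ∈ P.Z := Finset.mem_of_mem_erase hD
  obtain ⟨u, hu, w, hw, h⟩ := hconn D hDZ
  have hwR : w ∉ P.R₀ := not_mem_R₀_of_mem_zone hDZ hw
  have h' : P.RReach ∅ w := ⟨u, hu, (Set.mem_empty_iff_false _).1, reflTransGen_mono
    (fun _ _ hab => ⟨hab, (Set.mem_empty_iff_false _).1⟩) h⟩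
  obtain ⟨g, hg, hgw⟩ := reach_sub_of_reach hC.mem huniq h' hwR
  exact ⟨g, hg, w, hw, reflTransGen_mono (fun _ _ hab => hab.1) hgw.2⟩

/-- The sub-problem has one zone fewer. -/
theorem card_sub_Z {C : Finset V} (hC : C ∈ P.Z) : (P.sub C hC).Z.card = P.Z.card - 1 :=
  Finset.card_erase_of_mem hC

/-- The sub-problem's zones are zones of `P`. -/
theorem sub_Z_subset {C : Finset V} (hC : C ∈ P.Z) : (P.sub C hC).Z ⊆ P.Z := Finset.erase_subset C P.Z

/-- The sub-problem's port vertices are port vertices of `P`. -/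
theorem sub_PV_subset {C : Finset V} (hC : C ∈ P.Z) : (P.sub C hC).PV ⊆ P.PV := by
  rintro v ⟨D, hD, hv⟩
  exact ⟨D, sub_Z_subset hC hD, hv⟩

end Problem

end ZonePort

end PercRepro
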